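import Literature.MathematicalPhysics.QuantumFieldTheory.Balaban1983to89.TreeLengthTorusTransfer
import Literature.MathematicalPhysics.QuantumFieldTheory.Balaban1983to89.B16Ineq197ClassOne

/-!
# `Balaban1983to89.B13BlockGeometryTorus` — T. Bałaban, *Renormalization group approach to lattice gauge field
theories. II. Cluster expansions*, Commun. Math. Phys. **116** (1988) 1–22, doi:10.1007/bf01239022
[Balaban1988RG2Cluster], with the block geometry of [I] = T. Bałaban, *… I. Generation of effective actions …*, Commun.
Math. Phys. **109** (1987) 249–301 [Balaban1987RG1]: **[I]'s big cubes □, □̃ⁿ, □₀ = □̃⁵ as boxes of M-cubes on the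
papers' periodic carrier, and the count «8·12³» of (1.27) PROVED**

statement-level skeleton of published theorems with citation tags; proofs where landed; nothing here is a claim about
the Yang–Mills mass gap

PDFs held: `paper:balaban1988-cmp116-rg-ii-cluster`, `paper:balaban1987-cmp109-rg-i-small-field` (journal page = PDF
page + 0 resp. + 248); [I] p. 257, p. 270, p. 273 and [II] p. 8 re-read this session from the text layer.

CITATION HEADER / WHAT IS REPRODUCED (cell `pub-ymgap`, Track A node N10 = [B13], prover seat `pub-ymgap-dag-p2`, ninth
module; a NEW LEAF over `TreeLengthTorusTransfer` and `B16Ineq197ClassOne` (boxes `B16Absorption.pbox`), nothing there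
modified).  [I] p. 257, verbatim: *"We decompose the space T into the lattice of closed cubes of a size M … We denote
this family of cubes by π_j, and the cubes by □, □′, etc. For a cube □ ∈ π_j and n = 1, 2, … we define □̃ⁿ as a cube of
the size (1 + 2n)M and with a center at the center of □. … The meaning of the symbol X̃ⁿ should be obvious."*; [I]
p. 270: *"Let us take the partition π_k. We construct a cover of the space T by cubes □, which are unions of 2^d
neighbouring cubes from π_k."*; [I] p. 273: *"We take the function U_j constructed for the cube □₀ = □̃⁵"*; [II] p. 8
[PDF 8]: *"The sum over Y₀ is simply a sum over subsets of the family of cubes Δ contained in □₀∖□̃⁴. The number of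
terms in this sum is an absolute number … The sum is bounded by exp(8·12³exp(−½(κ₁ − 1))) ≤ e (1.27)"*.
READING (d = 4, unit = one M-cube of π_k, a cube of π_k = a point of ℤ⁴ resp. of the torus (ℤ/N)⁴): the cover cube
□ anchored at p = the 2⁴ cubes `pbox p (p + 1)`; its enlargements □̃ⁿ = the union of the □̃ⁿ of its M-cubes = the box
`pbox (p − n) (p + 1 + n)` of side 2 + 2n; □₀ = □̃⁵ has side 12, □̃⁴ side 10, □̃² side 6.  Hence the family of cubes Δ
of □₀∖□̃⁴ has EXACTLY 12⁴ − 10⁴ = 10736 members, and print's «8·12³» = 13824 is the bound 12⁴ − 10⁴ ≤ (12 − 10)·4·12³.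
* §1 (ℤ^d, any d; counts at d = 4): `pbox_margin_subset`, `card_pbox_margin` ((2 + 2n)^d), `card_box0_sdiff` (= 10736),
  `card_box0_sdiff_le` (≤ 8·12³ — THE PRINTED COUNT).
* §2 (torus (ℤ/N)^d): `card_tbox0_sdiff_le` (the torus images: #(□₀∖□̃⁴) ≤ 8·12³ for every
  N), `isTDom_image_pbox` (a box of cubes is a torus localization domain), `injOn_proj_pbox` / `card_image_pbox` (a box
  narrower than the torus embeds), `card_tbox0` (#□₀ = 12⁴ once N ≥ 12), `torusTreeLen_tbox0_le` (d_k(□₀) ≤ 12⁴ − 1, the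
  absolute number absorbed by exp O(1)κ₁ in (1.29)).
* §3 `tbox0_data` — the □₀-package consumed by the torus Lemma-1 theorems (`hblk` of
  `B13Lemma1Torus.lemma1Printed_twoTorus` … `B13Lemma1DepTorus.lemma1Printed_twoTorus_dep`): □₀ ⊆ Y a torus
  localization domain with d_k ≤ 12⁴ − 1 and ≥ 80 = 5·2⁴ cubes; `volY0_dominates` (M⁻⁴|Y₀∖□̃⁴| = #(Y∖□₀) + #W).
* §4 THE CUBES OF π_j INSIDE A k-SCALE BOX — [II] p. 8 *"To bound the first sum, over □′ ⊂ □̃², we use the factor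
  (L^jη)⁵ in (1.24). This yields (6L)⁴L^jη"*: on the tower π_j = `TPt d (m·N)`, m = L^{k−j} = (L^jη)⁻¹, a cube of
  π_j lies in the π_k-block `tcoarse m N` (`tcoarse_apply`); every block has at most m^d cubes of π_j
  (`card_fiber_tcoarse_le`), so the cubes of π_j inside a family B of blocks number ≤ m^d·#B
  (`card_filter_tcoarse_mem_le`); for B = □̃² (6⁴ blocks) this is 6⁴L^{4(k−j)}, whence **«(6L)⁴L^jη» PROVED** in the
  form consumed as `hq`: #{□′ ⊂ □̃²}·(L^jη)⁵ ≤ (6L)⁴·L^jη (`count_6L`).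
HONEST FRAMING: a count-neutral Track-A side landing (YM-PLAN §1); NOT a discharge of node N10; elementary finite
geometry of ℤ⁴ and (ℤ/N)⁴ ([folklore]) read against [I]'s located sentences; nothing continuum / OS / mass-gap / Clay.
-/

namespace Literature.MathematicalPhysics.QuantumFieldTheory.Balaban1983to89.B13BlockGeometryTorus

open Literature.MathematicalPhysics.QuantumFieldTheory.Balaban1983to89
open Literature.MathematicalPhysics.QuantumFieldTheory.Balaban1983to89.B13ScaleTransfer (Pt FaceConnected)
open Literature.MathematicalPhysics.QuantumFieldTheory.Balaban1983to89.B16Absorption (pbox mem_pbox)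
open Literature.MathematicalPhysics.QuantumFieldTheory.Balaban1983to89.B16Ineq197ClassOne
  (card_pbox_eq_pow faceConnected_pbox)
open Literature.MathematicalPhysics.QuantumFieldTheory.Balaban1983to89.TreeLengthTorus
open Literature.MathematicalPhysics.QuantumFieldTheory.Balaban1983to89.TreeLengthTorusGeometry
  (period exists_period_of_proj_eq)

/-! ## §1. The boxes □̃ⁿ of a cover cube in ℤ^d and the count «8·12³» -/

section Lattice

variable {d : ℕ}

/-- The enlargements are nested: □̃ᵐ ⊆ □̃ⁿ for m ≤ n ([I] p. 257 *"□̃ⁿ … a cube of the size (1 + 2n)M and with a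
center at the center of □"*, read for the 2M cover cubes of [I] p. 270). [cite: Balaban1987RG1, p.257 (definition of □̃ⁿ)] -/
theorem pbox_margin_subset (p : Pt d) {m n : ℕ} (h : m ≤ n) :
    pbox (fun i => p i - m) (fun i => p i + 1 + m) ⊆ pbox (fun i => p i - n) (fun i => p i + 1 + n) := by
  intro y hy
  rw [mem_pbox] at hy ⊢
  intro i
  have := hy i
  have hmn : (m : ℤ) ≤ n := by exact_mod_cast h
  constructor <;> linarith [this.1, this.2]

/-- The enlargement □̃ⁿ of a cover cube (2^d cubes of π_k, [I] p. 270) is a box of (2 + 2n)^d cubes of π_k.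
[cite: Balaban1987RG1, p.257 (definition of □̃ⁿ) and p.270 (cover cubes)] -/
theorem card_pbox_margin (p : Pt d) (n : ℕ) :
    (pbox (fun i => p i - n) (fun i => p i + 1 + n)).card = (2 * n + 2) ^ d :=
  card_pbox_eq_pow (N := 2 * n + 2) fun i => by push_cast; ring

/-- The cover cube itself (n = 0): 2^d cubes of π_k — [I] p. 270 *"unions of 2^d neighbouring cubes from π_k"*.
[cite: Balaban1987RG1, p.270 (cover cubes)] -/
theorem card_pbox_cover (p : Pt d) : (pbox p (fun i => p i + 1)).card = 2 ^ d :=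
  card_pbox_eq_pow (N := 2) fun i => by push_cast; ring

/-- **The family of cubes Δ of □₀∖□̃⁴ has exactly 12⁴ − 10⁴ = 10736 members** (d = 4; □₀ = □̃⁵ of side 12, □̃⁴ of side
10). [cite: Balaban1988RG2Cluster, (1.27) p.8] -/
theorem card_box0_sdiff (p : Pt 4) :
    (pbox (fun i => p i - (5 : ℕ)) (fun i => p i + 1 + (5 : ℕ)) \
      pbox (fun i => p i - (4 : ℕ)) (fun i => p i + 1 + (4 : ℕ))).card = 10736 := by
  rw [Finset.card_sdiff_of_subset (pbox_margin_subset p (by norm_num)), card_pbox_margin, card_pbox_margin]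
  norm_num

/-- **«8·12³»** (p. 8, (1.27): *"the family of cubes Δ contained in □₀∖□̃⁴ … exp(8·12³exp(−½(κ₁ − 1)))"*): the number
of cubes of □₀∖□̃⁴ is at most 8·12³ (= the mean-value bound 12⁴ − 10⁴ ≤ 2·4·12³; exactly 10736 ≤ 13824).
[cite: Balaban1988RG2Cluster, (1.27) p.8] -/
theorem card_box0_sdiff_le (p : Pt 4) :
    ((pbox (fun i => p i - (5 : ℕ)) (fun i => p i + 1 + (5 : ℕ)) \
      pbox (fun i => p i - (4 : ℕ)) (fun i => p i + 1 + (4 : ℕ))).card : ℝ) ≤ 8 * 12 ^ 3 := by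
  rw [card_box0_sdiff]; norm_num

end Lattice

/-! ## §2. The same boxes on the torus (ℤ/N)^d of cubes of π_k -/

section Torus

variable {d N : ℕ}

/-- Images commute with set difference up to inclusion: f(A) ∖ f(B) ⊆ f(A ∖ B).  Private plumbing. [folklore] -/
private theorem image_sdiff_subset_image {α β : Type*} [DecidableEq α] [DecidableEq β] (f : α → β) (A B : Finset α) :
    A.image f \ B.image f ⊆ (A \ B).image f := by
  intro y hy
  rw [Finset.mem_sdiff] at hy
  obtain ⟨x, hxA, rfl⟩ := Finset.mem_image.mp hy.1
  exact Finset.mem_image.mpr ⟨x, Finset.mem_sdiff.mpr ⟨hxA, fun hxB => hy.2 (Finset.mem_image_of_mem f hxB)⟩, rfl⟩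

/-- **«8·12³» ON THE TORUS**: for the torus images of □₀ = □̃⁵ and □̃⁴ (any number N of cubes per direction, wrapping
allowed), #(□₀∖□̃⁴) ≤ 8·12³. [cite: Balaban1988RG2Cluster, (1.27) p.8] -/
theorem card_tbox0_sdiff_le (N : ℕ) (p : Pt 4) :
    ((((pbox (fun i => p i - (5 : ℕ)) (fun i => p i + 1 + (5 : ℕ))).image (proj N)) \
      ((pbox (fun i => p i - (4 : ℕ)) (fun i => p i + 1 + (4 : ℕ))).image (proj N))).card : ℝ) ≤ 8 * 12 ^ 3 := by
  refine le_trans ?_ (card_box0_sdiff_le p)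
  exact_mod_cast (Finset.card_le_card (image_sdiff_subset_image _ _ _)).trans Finset.card_image_le

/-- A nonempty box of cubes of π_k projects to a torus localization domain ([I] p. 257: *"a localization domain …
is a union of a connected, finite family of cubes from π_j"*, on the periodic carrier of p. 251; boxes are
face-connected, `B16Ineq197ClassOne.faceConnected_pbox`, `TreeLengthTorus.tFaceConnected_image`).
[cite: Balaban1987RG1, p.257 (localization domains), p.251 (torus)] -/
theorem isTDom_image_pbox [NeZero N] {lo hi : Pt d} (h : ∀ i, lo i ≤ hi i) :
    IsTDom ((pbox lo hi).image (proj N)) := by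
  have hne : (pbox lo hi).Nonempty := ⟨lo, mem_pbox.mpr fun i => ⟨le_rfl, h i⟩⟩
  exact ⟨hne.image _, tFaceConnected_image (faceConnected_pbox lo hi)⟩

/-- A box narrower than the torus in every direction EMBEDS: `proj N` is injective on `pbox lo hi` when
`hi i < lo i + N` (two cubes of the box with the same class differ by a period, `exists_period_of_proj_eq`, which must
vanish) — [I] p. 251: *"a torus T obtained by the usual identification of boundary points of the cube"*.
[cite: Balaban1987RG1, p.251 (torus identification of the cube lattice)] -/
theorem injOn_proj_pbox {lo hi : Pt d} (h : ∀ i, hi i < lo i + N) :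
    Set.InjOn (proj N) (pbox lo hi : Set (Pt d)) := by
  intro x hx y hy hxy
  obtain ⟨k, hk⟩ := exists_period_of_proj_eq hxy
  rw [Finset.mem_coe, mem_pbox] at hx hy
  funext i
  have hki : y i = x i + (N : ℤ) * k i := by
    have := congrFun hk i
    simpa [period] using this
  have h1 := hx i; have h2 := hy i; have h3 := h i
  have hN : |(N : ℤ) * k i| < N := by
    rw [abs_lt]; constructor <;> linarith
  have hk0 : k i = 0 := by
    by_contra hne
    have h1k : 1 ≤ |k i| := Int.one_le_abs hne
    have hN0 : (0 : ℤ) ≤ N := by exact_mod_cast Nat.zero_le N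
    have : (N : ℤ) ≤ |(N : ℤ) * k i| := by
      rw [abs_mul, abs_of_nonneg hN0]
      nlinarith
    linarith
  rw [hki, hk0, mul_zero, add_zero]

/-- Cardinality of an embedded box on the torus = that of the box ([I] p. 251, the torus identification).
[cite: Balaban1987RG1, p.251 (torus identification of the cube lattice)] -/
theorem card_image_pbox {lo hi : Pt d} (h : ∀ i, hi i < lo i + N) :
    ((pbox lo hi).image (proj N)).card = (pbox lo hi).card :=
  Finset.card_image_of_injOn (injOn_proj_pbox h)

/-- **#□₀ = 12⁴ on every torus with at least 12 cubes of π_k per direction** ([I] p. 251: the tori have L^m ≫ 12 unit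
cubes per direction). [cite: Balaban1987RG1, p.273 (□₀ = □̃⁵)] -/
theorem card_tbox0 (hN : 12 ≤ N) (p : Pt 4) :
    ((pbox (fun i => p i - (5 : ℕ)) (fun i => p i + 1 + (5 : ℕ))).image (proj N)).card = 12 ^ 4 := by
  rw [card_image_pbox (fun i => by push_cast; omega), card_pbox_margin]

/-- **d_k(□₀) is an absolute number**: the tree length of the torus image of □₀ is at most 12⁴ − 1 (the crude bound
#cubes − 1, `TreeLengthTorus.torusTreeLen_le_card_sub_one`; print absorbs exp(⅛κ₁d_k(□₀)) of (1.25) into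
«exp O(1)κ₁» of (1.29)). [cite: Balaban1988RG2Cluster, (1.25)/(1.29) pp.7–8] -/
theorem torusTreeLen_tbox0_le [NeZero N] (p : Pt 4) :
    torusTreeLen ((pbox (fun i => p i - (5 : ℕ)) (fun i => p i + 1 + (5 : ℕ))).image (proj N)) ≤ 12 ^ 4 - 1 := by
  have hdom := isTDom_image_pbox (N := N) (lo := fun i => p i - (5 : ℕ)) (hi := fun i => p i + 1 + (5 : ℕ))
    (fun i => by push_cast; omega)
  refine (torusTreeLen_le_card_sub_one hdom.1 hdom.2).trans ?_
  have hc : (((pbox (fun i => p i - (5 : ℕ)) (fun i => p i + 1 + (5 : ℕ))).image (proj N)).card : ℝ) ≤ 12 ^ 4 := by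
    have h := (Finset.card_image_le (f := proj N)
      (s := pbox (fun i => p i - (5 : ℕ)) (fun i => p i + 1 + (5 : ℕ)))).trans (card_pbox_margin p 5).le
    exact_mod_cast h
  linarith

/-! ## §3. The □₀-package of the torus Lemma-1 theorems -/

/-- **THE □₀-PACKAGE** consumed as `hblk` by `B13Lemma1Torus.lemma1Printed_twoTorus` /
`B13Lemma1TorusFull.lemma1Printed_twoTorus_full` / `B13Lemma1TorusTower.lemma1Printed_twoTorus_tower` /
`B13Lemma1DepTorus.lemma1Printed_twoTorus_dep`: on a torus with N ≥ 12 cubes of π_k per direction, the torus image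
of □₀ = □̃⁵ (anchor p), once contained in Y, is a torus localization domain ⊆ Y with d_k(□₀) ≤ 12⁴ − 1 and at least
80 = 5·2⁴ cubes. [cite: Balaban1987RG1, p.273 (□₀ = □̃⁵); Balaban1988RG2Cluster, (1.25) p.7] -/
theorem tbox0_data [NeZero N] (hN : 12 ≤ N) (p : Pt 4) {Y : Finset (TPt 4 N)}
    (hY : (pbox (fun i => p i - (5 : ℕ)) (fun i => p i + 1 + (5 : ℕ))).image (proj N) ⊆ Y) :
    (pbox (fun i => p i - (5 : ℕ)) (fun i => p i + 1 + (5 : ℕ))).image (proj N) ⊆ Y ∧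
      IsTDom ((pbox (fun i => p i - (5 : ℕ)) (fun i => p i + 1 + (5 : ℕ))).image (proj N)) ∧
      torusTreeLen ((pbox (fun i => p i - (5 : ℕ)) (fun i => p i + 1 + (5 : ℕ))).image (proj N)) ≤ 12 ^ 4 - 1 ∧
      (5 : ℝ) * 2 ^ 4 ≤ ((pbox (fun i => p i - (5 : ℕ)) (fun i => p i + 1 + (5 : ℕ))).image (proj N)).card := by
  refine ⟨hY, isTDom_image_pbox fun i => by push_cast; omega, torusTreeLen_tbox0_le p, ?_⟩
  rw [card_tbox0 hN p]; norm_num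

/-- **M⁻⁴|Y₀∖□̃⁴| AS A NUMBER OF CUBES** (p. 7: *"exp(−(κ₁ − 1)M⁻⁴|Y₀∖□̃⁴|) … where Y = Y₀ ∪ □₀"*; p. 8: Y₀ ↔ the
subsets W of the cubes of □₀∖□̃⁴): with B = the cubes of □₀ ⊆ Y and Y₀∖□̃⁴ = (Y∖□₀) ⊔ W, the number
N = #(Y∖B) + #W dominates both #(Y∖B) (the input `hNblk`) and #W (the input `hN` of (1.27)). [cite: Balaban1988RG2Cluster, (1.24)–(1.27) pp.7–8] -/
theorem volY0_dominates {α : Type*} [DecidableEq α] (Y B W : Finset α) :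
    ((Y \ B).card : ℝ) ≤ (Y \ B).card + W.card ∧ (W.card : ℝ) ≤ (Y \ B).card + W.card :=
  ⟨le_add_of_nonneg_right (Nat.cast_nonneg _), le_add_of_nonneg_left (Nat.cast_nonneg _)⟩

/-! ## §4. The cubes of π_j inside a k-scale box: «(6L)⁴L^jη» -/

/-- The block map read coordinatewise: the cube q of π_j (m = L^{k−j} cubes of π_j per cube of π_k and direction)
lies in the π_k-cube of index ⌊q_i/m⌋ — [II] p. 13 *"cubes of the size LM"*, iterated k − j times
(`TreeLengthTorusTransfer.tcoarse`). [cite: Balaban1988RG2Cluster, p.13 (cubes of the size LM)] -/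
theorem tcoarse_apply (m N : ℕ) [NeZero m] [NeZero N] (q : TPt d (m * N)) (i : Fin d) :
    TreeLengthTorusTransfer.tcoarse m N q i = (((q i).val / m : ℕ) : ZMod N) := by
  show ((((q i).val : ℤ) / (m : ℤ) : ℤ) : ZMod N) = _
  rw [← Int.natCast_div, Int.cast_natCast]

/-- **Every cube of π_k contains at most m^d cubes of π_j** (m = L^{k−j}; in fact exactly m^d): the fibres of the
block map `tcoarse m N` have at most m^d elements (inject a fibre into the residues mod m).  [I] p. 251: the nested
lattices L^{−n}ℤ^d of the torus. [cite: Balaban1987RG1, p.251 (the nested cube lattices of the torus)] -/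
theorem card_fiber_tcoarse_le (m N : ℕ) [NeZero m] [NeZero N] (y : TPt d N) :
    ((Finset.univ : Finset (TPt d (m * N))).filter
      (fun q => TreeLengthTorusTransfer.tcoarse m N q = y)).card ≤ m ^ d := by
  classical
  have hm : 0 < m := Nat.pos_of_ne_zero (NeZero.ne m)
  have hcard : (Fintype.piFinset fun _ : Fin d => Finset.range m).card = m ^ d := by
    rw [Fintype.card_piFinset]; simp
  rw [← hcard]
  refine Finset.card_le_card_of_injOn (fun q i => (q i).val % m) (fun q _ => ?_) ?_
  · rw [Finset.mem_coe, Fintype.mem_piFinset]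
    exact fun i => Finset.mem_range.mpr (Nat.mod_lt _ hm)
  · intro q hq q' hq' hrr
    rw [Finset.mem_coe, Finset.mem_filter] at hq hq'
    funext i
    have hlt : ∀ r : TPt d (m * N), (r i).val / m < N := fun r =>
      (Nat.div_lt_iff_lt_mul hm).mpr (by simpa [mul_comm] using (r i).val_lt)
    have hquot : (q i).val / m = (q' i).val / m := by
      have h1 := congrFun hq.2 i
      have h2 := congrFun hq'.2 i
      rw [tcoarse_apply] at h1 h2
      have h12 : (((q i).val / m : ℕ) : ZMod N) = (((q' i).val / m : ℕ) : ZMod N) := by rw [h1, h2]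
      rw [ZMod.natCast_eq_natCast_iff'] at h12
      rwa [Nat.mod_eq_of_lt (hlt q), Nat.mod_eq_of_lt (hlt q')] at h12
    have hrem : (q i).val % m = (q' i).val % m := congrFun hrr i
    have hv : (q i).val = (q' i).val := by
      rw [← Nat.div_add_mod (q i).val m, ← Nat.div_add_mod (q' i).val m, hquot, hrem]
    exact ZMod.val_injective _ hv

/-- **The cubes of π_j inside a family B of cubes of π_k number at most m^d·#B** (m = L^{k−j}).
[cite: Balaban1988RG2Cluster, p.8 (the sum over □′ ⊂ □̃²)] -/
theorem card_filter_tcoarse_mem_le (m N : ℕ) [NeZero m] [NeZero N] (B : Finset (TPt d N)) :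
    ((Finset.univ : Finset (TPt d (m * N))).filter
      (fun q => TreeLengthTorusTransfer.tcoarse m N q ∈ B)).card ≤ m ^ d * B.card := by
  classical
  set s := (Finset.univ : Finset (TPt d (m * N))).filter (fun q => TreeLengthTorusTransfer.tcoarse m N q ∈ B)
    with hs
  have h1 : s.card ≤ m ^ d * (s.image (TreeLengthTorusTransfer.tcoarse m N)).card :=
    Finset.card_le_mul_card_image s (m ^ d) fun y _ =>
      (Finset.card_le_card (Finset.filter_subset_filter _ (Finset.filter_subset _ _) |>.trans
        (by intro q hq; simpa using hq))).trans (card_fiber_tcoarse_le m N y)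
  have h2 : s.image (TreeLengthTorusTransfer.tcoarse m N) ⊆ B := by
    intro y hy
    obtain ⟨q, hq, rfl⟩ := Finset.mem_image.mp hy
    exact (Finset.mem_filter.mp hq).2
  exact h1.trans (Nat.mul_le_mul_left _ (Finset.card_le_card h2))

/-- **«(6L)⁴L^jη» PROVED** ([II] p. 8: *"To bound the first sum, over □′ ⊂ □̃², we use the factor (L^jη)⁵ in (1.24).
This yields (6L)⁴L^jη"*): on the tower π_j = `TPt 4 (L^{k−j}·N)` the cubes □′ of π_j inside □̃² (the π_k-box of
side 6 around the cover cube anchored at p) number at most 6⁴L^{4(k−j)}, so that, with L^jη = L^j·(L^k)⁻¹,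
#{□′ ⊂ □̃²}·(L^jη)⁵ ≤ 6⁴·L^jη ≤ (6L)⁴·L^jη — the form of the hypothesis `hq` of the torus Lemma-1 theorems.
[cite: Balaban1988RG2Cluster, p.8 (the sum over □′ ⊂ □̃²)] -/
theorem count_6L (L N k j : ℕ) [NeZero L] [NeZero N] (hjk : j ≤ k) (p : Pt 4) :
    (((Finset.univ : Finset (TPt 4 (L ^ (k - j) * N))).filter
        (fun q => TreeLengthTorusTransfer.tcoarse (L ^ (k - j)) N q ∈
          (pbox (fun i => p i - (2 : ℕ)) (fun i => p i + 1 + (2 : ℕ))).image (proj N))).card : ℝ) *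
        ((L : ℝ) ^ j * ((L : ℝ) ^ k)⁻¹) ^ 5 ≤
      (6 * (L : ℝ)) ^ 4 * ((L : ℝ) ^ j * ((L : ℝ) ^ k)⁻¹) := by
  have hLn : 0 < L := Nat.pos_of_ne_zero (NeZero.ne L)
  have hL0 : (0 : ℝ) < L := by exact_mod_cast hLn
  have hL1 : (1 : ℝ) ≤ L := by exact_mod_cast hLn
  have hm0 : (0 : ℝ) < ((L ^ (k - j) : ℕ) : ℝ) := by exact_mod_cast pow_pos hLn _
  -- the count: ≤ (L^{k−j})⁴·6⁴
  have hcnt : (((Finset.univ : Finset (TPt 4 (L ^ (k - j) * N))).filter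
      (fun q => TreeLengthTorusTransfer.tcoarse (L ^ (k - j)) N q ∈
        (pbox (fun i => p i - (2 : ℕ)) (fun i => p i + 1 + (2 : ℕ))).image (proj N))).card : ℝ) ≤
      ((L ^ (k - j) : ℕ) : ℝ) ^ 4 * 6 ^ 4 := by
    have h := card_filter_tcoarse_mem_le (L ^ (k - j)) N
      ((pbox (fun i => p i - (2 : ℕ)) (fun i => p i + 1 + (2 : ℕ))).image (proj N))
    have hB : ((pbox (fun i => p i - (2 : ℕ)) (fun i => p i + 1 + (2 : ℕ))).image (proj N)).card ≤ 6 ^ 4 :=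
      Finset.card_image_le.trans (card_pbox_margin p 2).le
    exact_mod_cast h.trans (Nat.mul_le_mul_left _ hB)
  -- L^jη = (L^{k−j})⁻¹
  have hℓ : (L : ℝ) ^ j * ((L : ℝ) ^ k)⁻¹ = (((L ^ (k - j) : ℕ) : ℝ))⁻¹ := by
    rw [Nat.cast_pow, ← Nat.add_sub_cancel' hjk, pow_add, Nat.add_sub_cancel' hjk, mul_inv, ← mul_assoc,
      mul_inv_cancel₀ (pow_ne_zero _ hL0.ne'), one_mul]
  rw [hℓ]
  have hL4 : (1 : ℝ) ≤ (L : ℝ) ^ 4 := one_le_pow₀ hL1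
  calc _ ≤ ((L ^ (k - j) : ℕ) : ℝ) ^ 4 * 6 ^ 4 * ((((L ^ (k - j) : ℕ) : ℝ))⁻¹) ^ 5 :=
        mul_le_mul_of_nonneg_right hcnt (by positivity)
    _ = 6 ^ 4 * (((L ^ (k - j) : ℕ) : ℝ))⁻¹ := by field_simp
    _ ≤ 6 ^ 4 * (L : ℝ) ^ 4 * (((L ^ (k - j) : ℕ) : ℝ))⁻¹ := by
        have : (0 : ℝ) ≤ 6 ^ 4 * (((L ^ (k - j) : ℕ) : ℝ))⁻¹ := by positivity
        nlinarith
    _ = (6 * (L : ℝ)) ^ 4 * (((L ^ (k - j) : ℕ) : ℝ))⁻¹ := by ring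

end Torus

end Literature.MathematicalPhysics.QuantumFieldTheory.Balaban1983to89.B13BlockGeometryTorus
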